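import Summits.AnomalousDissipation.AnomalousDissipation.Theses.ImpulseGrid

/-!
# Sketch — crux GridSigns (stmt-AnomalousDissipation-1771), crux-ideate round 1, ideator 1

First lemmas of the idea cards (they must elaborate; proofs where cheap).

* `GridSignsSwept`, `gridSigns_of_swept` — card `imprint-subtraction-production-signs`:
  the sign condition (b) is EQUIVALENT (given the support item `GridInjectionIdentity`) to a
  floor on the SWEPT injection `Λ⟨(ΦG,u)⟩ − Λ⟨(G,u)⟩ ≥ η/c − (ν/c)Λ⟨(u,Δ(ΨG))⟩`; proved here.
* `ImprintSubtraction` — same card: the exact algebraic identity behind the production reading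
  `∫⟪w,(w·∇)(ΨG)⟫ = ∫⟪v,(v·∇)(ΨG)⟫ + c⁻¹∫Ψ²⟪v,(G·∇)G⟫`, `v = w − c⁻¹ΨG` (statement only).
* `signedLobe_unitMass` — card `signed-lobe-slab-profiles`: signed two-slab profiles keep unit mass
  (proved), so they are admissible designs of `GridSigns`.
* `GridSignsCoherent`, statement of the coherent-wake reduction (remark in card 1).
-/

namespace Summit.AnomalousDissipation.AnomalousDissipation.Cruxes.GridSigns.SketchIdeator1

open MeasureTheory Filter
open Literature.Analysis.FunctionSpaces.Torus Literature.Analysis.FluidPDE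
open Summit.AnomalousDissipation.AnomalousDissipation.Theses.ImpulseGrid

local notation "𝕋³" => UnitAddTorus (Fin 3)
local notation "E³" => EuclideanSpace ℝ (Fin 3)

/-- `GridSigns` with the sign condition (b) rewritten as a SWEPT-INJECTION FLOOR
`η ≤ c·(Λ⟨(ΦG,u_j)⟩ − Λ⟨(G,u_j)⟩) + ν_j Λ⟨(u_j, Δ(ΨG))⟩` (plus the per-`j` sup-in-time energy
clause, automatic at `ν_j > 0` by Correlation.AbsorbingBallLHTorus, needed to invoke
`GridInjectionIdentity`). -/
def GridSignsSwept : Prop :=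
  ∃ (Φ Ψ : 𝕋³ → ℝ) (G : 𝕋³ → E³) (c η : ℝ) (Λ : GeneralizedLimit),
    IsSmooth Φ ∧ IsSmooth Ψ ∧ IsSmooth G ∧
    (∀ (s : UnitAddCircle) x, Ψ (x + Pi.single (1 : Fin 3) s) = Ψ x ∧ Ψ (x + Pi.single (2 : Fin 3) s) = Ψ x) ∧
    (∀ (s : UnitAddCircle) x, G (x + Pi.single (0 : Fin 3) s) = G x) ∧ (∀ x, G x 0 = 0) ∧ IsDivFree G ∧
    (∀ x, partialDeriv 0 Ψ x = Φ x - 1) ∧ (∫ x, Φ x * Ψ x * ‖G x‖ ^ 2 = 0) ∧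
    IsSmooth (fun x => Φ x • G x) ∧ IsDivFree (fun x => Φ x • G x) ∧ HasZeroMean (fun x => Φ x • G x) ∧
    0 < c ∧ 0 < η ∧
    ∃ (ν : ℕ → ℝ) (u₀ : ℕ → 𝕋³ → E³) (u : ℕ → ℝ → 𝕋³ → E³),
      (∀ j, 0 < ν j) ∧ Tendsto ν atTop (nhds 0) ∧
      (∀ j, Torus.IsGlobalLerayHopf (ν j) (fun _ => fun x => Φ x • G x) (u₀ j) (u j)) ∧
      (∀ j, ∃ C : ℝ, ∀ t : ℝ, 0 ≤ t → kineticEnergy (u j t) ≤ C) ∧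
      (∀ j, ∫ x, u₀ j x = c • EuclideanSpace.single 0 1) ∧
      (∃ E : ℝ, ∀ j, meanEnergy (u j) ≤ E) ∧
      (∀ j, 0 ≤ Λ.longTimeAvg (fun t => ∫ x, inner ℝ (G x) (u j t x))) ∧
      (∀ j, η ≤ c * (Λ.longTimeAvg (fun t => ∫ x, inner ℝ (Φ x • G x) (u j t x))
                    - Λ.longTimeAvg (fun t => ∫ x, inner ℝ (G x) (u j t x)))
              + ν j * Λ.longTimeAvg (fun t => ∫ x, inner ℝ (u j t x) (laplacian (fun y => Ψ y • G y) x)))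

/-- FIRST LEMMA of card `imprint-subtraction-production-signs` (proved): given the support item
`GridInjectionIdentity` (stmt-1774, provable now), the swept-injection form implies `GridSigns`
(the converse is the same algebra). -/
theorem gridSigns_of_swept (hI : GridInjectionIdentity) (hS : GridSignsSwept) : GridSigns := by
  obtain ⟨Φ, Ψ, G, c, η, Λ, hΦ, hΨ, hG, hΨinv, hGinv, hG0, hGdiv, hΨ', hnorm, hf1, hf2, hf3, hc, hη,
    ν, u₀, u, hν, hν0, hLH, hsup, hmom, hE, ha, hb⟩ := hS
  refine ⟨Φ, Ψ, G, c, η, Λ, hΦ, hΨ, hG, hΨinv, hGinv, hG0, hGdiv, hΨ', hnorm, hf1, hf2, hf3, hc, hη,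
    ν, u₀, u, hν, hν0, hLH, hmom, hE, ha, fun j => ?_⟩
  have h1 := (hI Λ (ν j) c Φ Ψ G (u₀ j) (u j) (hν j) hΦ hΨ hG hΨinv hGinv hG0 hGdiv hΨ' (hLH j) (hsup j)).1
  have h2 := hb j
  rw [hnorm] at h1
  linarith

/-- The exact IMPRINT-SUBTRACTION IDENTITY (statement; pure torus calculus — integration by parts
with `div v = 0`, `G₀ = 0`, `∂₀G = 0`, `Ψ = Ψ(x₀)`): subtracting the frozen inviscid wake
`c⁻¹Ψ G` from `w` turns the Reynolds-stress work against `∇(ΨG)` into the defect's production off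
the imprint plus an explicit cross term. Stated for smooth fields; the card uses it slice-wise in
`x₀` through the admissible test fields `h(x₀)G(x⊥)`. -/
def ImprintSubtraction : Prop :=
  ∀ (Ψ : 𝕋³ → ℝ) (G w : 𝕋³ → E³) (c : ℝ), c ≠ 0 → IsSmooth Ψ → IsSmooth G → IsSmooth w →
    (∀ (s : UnitAddCircle) x, Ψ (x + Pi.single (1 : Fin 3) s) = Ψ x ∧ Ψ (x + Pi.single (2 : Fin 3) s) = Ψ x) →
    (∀ (s : UnitAddCircle) x, G (x + Pi.single (0 : Fin 3) s) = G x) → (∀ x, G x 0 = 0) → IsDivFree G →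
    IsDivFree w →
    let v : 𝕋³ → E³ := fun x => w x - c⁻¹ • Ψ x • G x
    ∫ x, inner ℝ (w x) (convect w (fun y => Ψ y • G y) x)
      = (∫ x, inner ℝ (v x) (convect v (fun y => Ψ y • G y) x))
        + c⁻¹ * ∫ x, (Ψ x) ^ 2 * inner ℝ (v x) (convect G G x)

/-- Card `signed-lobe-slab-profiles`, first lemma (proved): a signed two-slab profile
`(1+β)φ − βφ(· − p)` built from a unit-mass profile has unit mass, for EVERY real `β` — so
`Φ_β` with its sawtooth `Ψ_β` is an admissible design of `GridSigns`/`GridSignsLaw` while the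
imprint energy `∫Ψ_β²` grows like `β²`. -/
theorem signedLobe_unitMass (φ : 𝕋³ → ℝ) (hφ : Integrable φ) (h1 : ∫ x, φ x = 1) (β : ℝ) (p : 𝕋³) :
    ∫ x, ((1 + β) * φ x - β * φ (x - p)) = 1 := by
  have hshift : ∫ x, φ (x - p) = ∫ x, φ x := integral_sub_right_eq_self φ p
  have hφ' : Integrable (fun x => φ (x - p)) := hφ.comp_sub_right p
  rw [integral_sub (hφ.const_mul _) (hφ'.const_mul _), integral_const_mul, integral_const_mul, hshift, h1]
  ring

/-- COHERENT-WAKE REDUCTION (statement; remark R of card 1): `GridSigns` follows from a family of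
time-PERIODIC classical wakes with drift `c`, bounded energy, nonnegative period-mean resonant
work `(G,u)` and period-mean dissipation exceeding it by `η/c` — for classical solutions the
energy equality turns the dissipation excess into the swept floor, and the same family discharges
the no-leak clause of the sibling crux `BoundedEnergyNoLeakGrid`. -/
def GridSignsCoherent : Prop :=
  ∃ (Φ Ψ : 𝕋³ → ℝ) (G : 𝕋³ → E³) (c η : ℝ),
    IsSmooth Φ ∧ IsSmooth Ψ ∧ IsSmooth G ∧
    (∀ (s : UnitAddCircle) x, Ψ (x + Pi.single (1 : Fin 3) s) = Ψ x ∧ Ψ (x + Pi.single (2 : Fin 3) s) = Ψ x) ∧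
    (∀ (s : UnitAddCircle) x, G (x + Pi.single (0 : Fin 3) s) = G x) ∧ (∀ x, G x 0 = 0) ∧ IsDivFree G ∧
    (∀ x, partialDeriv 0 Ψ x = Φ x - 1) ∧ (∫ x, Φ x * Ψ x * ‖G x‖ ^ 2 = 0) ∧
    IsSmooth (fun x => Φ x • G x) ∧ IsDivFree (fun x => Φ x • G x) ∧ HasZeroMean (fun x => Φ x • G x) ∧
    0 < c ∧ 0 < η ∧
    ∃ (ν τ : ℕ → ℝ) (u : ℕ → ℝ → 𝕋³ → E³) (p : ℕ → ℝ → 𝕋³ → ℝ),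
      (∀ j, 0 < ν j) ∧ Tendsto ν atTop (nhds 0) ∧
      (∀ j, IsClassicalNSSolutionOn Set.univ (ν j) (fun _ => fun x => Φ x • G x) (u j) (p j) ∧ 0 < τ j ∧
        Function.Periodic (u j) (τ j)) ∧
      (∀ j, ∫ x, u j 0 x = c • EuclideanSpace.single 0 1) ∧
      (∃ E : ℝ, ∀ j t, ∫ x, ‖u j t x‖ ^ 2 ≤ E) ∧
      (∀ j, 0 ≤ ∫ t in (0 : ℝ)..τ j, ∫ x, inner ℝ (G x) (u j t x)) ∧
      (∀ j, (τ j) * η ≤ c * ∫ t in (0 : ℝ)..τ j, (ν j * gradNormSq (u j t) - ∫ x, inner ℝ (G x) (u j t x))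
          + ν j * ∫ t in (0 : ℝ)..τ j, ∫ x, inner ℝ (u j t x) (laplacian (fun y => Ψ y • G y) x))

/-- The reduction to prove (≈ CoherentStatesAssembly bookkeeping + energy equality of classical
solutions + `GridInjectionIdentity`): coherent loud wakes with nonnegative resonant work give
`GridSigns`. -/
def GridSignsOfCoherent : Prop := GridSignsCoherent → GridSigns

end Summit.AnomalousDissipation.AnomalousDissipation.Cruxes.GridSigns.SketchIdeator1
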